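import Mathlib

/-!
# Tier7/Line3/LatticeBoxCount — lattice points in a box (seat t7-x1)

LINE 3 (t7-plan-3), the two-torus relative trace formula, version-(ii) isolation (p1 l. 14840 (2)(ii); the
dominant-term rows 659 / 660 / 670 / 674 and `T7SupportDominantGeometricSide`). The dominant-term argument takes a
COUNT hypothesis «`count_bound`: the orbits of size `≤ R` carrying weight number at most `C′ (1 + R)^β`» with
`β < α` (`α` = the decay exponent of the archimedean factor). With the weight-5 components `π⁰_adj` prescribed at
`ι₂, ι₃` (STATUS l. 14916 (2)) the decay exponent is `α = 5/2` in `size = max(|x|_{ι₂}, |x|_{ι₃})`, so the count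
needed is the BOX count of the values `x = κ(γ) − κ(γ₀)`, which lie in a lattice `M⁻¹ O_F ⊂ ℝ³` (the three real
embeddings) with `|x|_{ι₁} ≤ 1` (`KappaDefiniteBound`): `#{x ∈ Λ : |x_i| ≤ R_i} ≤ K · ∏_i (2 R_i + 3)`, `β = 2`.

THIS FILE proves that elementary lattice fact for an arbitrary additive subgroup `Λ ⊆ ι → ℝ` whose unit box
`{x ∈ Λ : ∀ i, |x i| ≤ 1}` is FINITE (`K` = its cardinality; for a discrete subgroup this is the compactness of
the cube): cover the box by the integer-translate unit cells `⌊x⌋ = m`, `m ∈ ∏ [−⌈R_i⌉, ⌈R_i⌉]`; two lattice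
points of one cell differ by a point of the unit box (`abs_sub_lt_one_of_floor_eq_floor`), so
`x ↦ (⌊x⌋, x − base ⌊x⌋)` is injective into `cells × unit box`.

Mathlib only; nothing here is about a number field, a group, a double coset or a period. Blind lane; no sorry;
axioms ⊆ {propext, Classical.choice, Quot.sound}.
-/

namespace Summit.Ventures.HodgeRepro2.Tier7.Line3.LatticeBoxCount

variable {ι : Type*} [Fintype ι] [DecidableEq ι]

/-- the integer cell of a point: `⌊x i⌋` coordinatewise. -/
noncomputable def cell (x : ι → ℝ) : ι → ℤ := fun i => ⌊x i⌋

/-- the unit box of `Λ`: its points with all coordinates in `[-1, 1]`. -/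
def unitBox (Λ : AddSubgroup (ι → ℝ)) : Set (ι → ℝ) := {x | x ∈ Λ ∧ ∀ i, |x i| ≤ 1}

/-- the box of `Λ` with sides `R i`: its points with `|x i| ≤ R i`. -/
def box (Λ : AddSubgroup (ι → ℝ)) (R : ι → ℝ) : Set (ι → ℝ) := {x | x ∈ Λ ∧ ∀ i, |x i| ≤ R i}

/-- the cells met by the box: `m i ∈ [-⌈R i⌉₊, ⌈R i⌉₊]`. -/
noncomputable def cells (R : ι → ℝ) : Finset (ι → ℤ) :=
  Fintype.piFinset fun i => Finset.Icc (-(⌈R i⌉₊ : ℤ)) (⌈R i⌉₊ : ℤ)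

omit [Fintype ι] [DecidableEq ι] in
/-- **two lattice points of one cell differ by a point of the unit box.** -/
theorem sub_mem_unitBox {Λ : AddSubgroup (ι → ℝ)} {x y : ι → ℝ} (hx : x ∈ Λ) (hy : y ∈ Λ)
    (h : cell x = cell y) : x - y ∈ unitBox Λ := by
  refine ⟨Λ.sub_mem hx hy, fun i => ?_⟩
  have hi : ⌊x i⌋ = ⌊y i⌋ := congrFun h i
  exact (Int.abs_sub_lt_one_of_floor_eq_floor hi).le

/-- **the cell of a box point lies in `cells R`.** -/
theorem cell_mem_cells {Λ : AddSubgroup (ι → ℝ)} {R : ι → ℝ} {x : ι → ℝ} (hx : x ∈ box Λ R) :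
    cell x ∈ cells R := by
  rw [cells, Fintype.mem_piFinset]
  intro i
  have hxi := hx.2 i
  rw [abs_le] at hxi
  have hR : R i ≤ (⌈R i⌉₊ : ℝ) := Nat.le_ceil _
  rw [Finset.mem_Icc]
  constructor
  · rw [cell, Int.le_floor]
    push_cast
    linarith [hxi.1]
  · have : (⌊x i⌋ : ℝ) ≤ (⌈R i⌉₊ : ℝ) := (Int.floor_le _).trans (hxi.2.trans hR)
    exact_mod_cast this

/-- a base point of each non-empty cell of `Λ` (any point; `0` if the cell is empty). -/
noncomputable def base (Λ : AddSubgroup (ι → ℝ)) (m : ι → ℤ) : ι → ℝ :=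
  open scoped Classical in
  if h : ∃ x, x ∈ Λ ∧ cell x = m then Classical.choose h else 0

omit [Fintype ι] [DecidableEq ι] in
/-- the base point of the cell of a lattice point is a lattice point of the same cell. -/
theorem base_spec (Λ : AddSubgroup (ι → ℝ)) {x : ι → ℝ} (hx : x ∈ Λ) :
    base Λ (cell x) ∈ Λ ∧ cell (base Λ (cell x)) = cell x := by
  have h : ∃ y, y ∈ Λ ∧ cell y = cell x := ⟨x, hx, rfl⟩
  simp only [base, dif_pos h]
  exact Classical.choose_spec h

/-- the injection `x ↦ (⌊x⌋, x − base ⌊x⌋)` of the box into `cells R × unit box`. -/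
noncomputable def code (Λ : AddSubgroup (ι → ℝ)) (x : ι → ℝ) : (ι → ℤ) × (ι → ℝ) :=
  (cell x, x - base Λ (cell x))

/-- the code of a box point lies in `cells R × unit box`. -/
theorem code_mem {Λ : AddSubgroup (ι → ℝ)} {R : ι → ℝ} {x : ι → ℝ} (hx : x ∈ box Λ R) :
    code Λ x ∈ (cells R : Set (ι → ℤ)) ×ˢ unitBox Λ := by
  refine ⟨cell_mem_cells hx, ?_⟩
  obtain ⟨hb, hbc⟩ := base_spec Λ hx.1
  exact sub_mem_unitBox hx.1 hb hbc.symm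

omit [Fintype ι] [DecidableEq ι] in
/-- the code map is injective on every box (indeed on `Λ`). -/
theorem code_injOn (Λ : AddSubgroup (ι → ℝ)) (R : ι → ℝ) : Set.InjOn (code Λ) (box Λ R) := by
  intro x _ y _ hxy
  simp only [code, Prod.mk.injEq] at hxy
  obtain ⟨h1, h2⟩ := hxy
  rw [h1] at h2
  exact sub_left_injective h2

/-- the number of cells met by the box: `∏ (2 ⌈R i⌉₊ + 1)`. -/
theorem card_cells (R : ι → ℝ) : (cells R).card = ∏ i, (2 * ⌈R i⌉₊ + 1) := by
  rw [cells, Fintype.card_piFinset]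
  refine Finset.prod_congr rfl fun i _ => ?_
  rw [Int.card_Icc]
  omega

/-- **the box is finite** when the unit box is. -/
theorem box_finite (Λ : AddSubgroup (ι → ℝ)) (hK : (unitBox Λ).Finite) (R : ι → ℝ) :
    (box Λ R).Finite :=
  Set.Finite.of_finite_image (((cells R).finite_toSet.prod hK).subset
    (Set.image_subset_iff.2 fun _ hx => code_mem hx)) (code_injOn Λ R)

/-- **the lattice box count**: `#{x ∈ Λ : ∀ i, |x i| ≤ R i} ≤ (∏ i, (2 ⌈R i⌉₊ + 1)) · #(unit box)`. -/
theorem ncard_box_le (Λ : AddSubgroup (ι → ℝ)) (hK : (unitBox Λ).Finite) (R : ι → ℝ) :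
    (box Λ R).ncard ≤ (∏ i, (2 * ⌈R i⌉₊ + 1)) * (unitBox Λ).ncard := by
  have h := Set.ncard_le_ncard_of_injOn (code Λ) (fun _ hx => code_mem hx) (code_injOn Λ R)
    ((cells R).finite_toSet.prod hK)
  rw [Set.ncard_prod, Set.ncard_coe_finset, card_cells] at h
  exact h

/-- the real form: `2 ⌈R⌉₊ + 1 ≤ 2 R + 3` for `R ≥ 0`. -/
theorem two_ceil_add_one_le (R : ℝ) (hR : 0 ≤ R) : ((2 * ⌈R⌉₊ + 1 : ℕ) : ℝ) ≤ 2 * R + 3 := by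
  have h : (⌈R⌉₊ : ℝ) ≤ R + 1 := by
    have := Nat.ceil_lt_add_one hR
    exact this.le
  push_cast
  linarith

/-- **the box count in real form**: `#{x ∈ Λ : ∀ i, |x i| ≤ R i} ≤ K · ∏ i, (2 R i + 3)`, `K = #(unit box)`. -/
theorem ncard_box_le_real (Λ : AddSubgroup (ι → ℝ)) (hK : (unitBox Λ).Finite) (R : ι → ℝ)
    (hR : ∀ i, 0 ≤ R i) :
    ((box Λ R).ncard : ℝ) ≤ ((unitBox Λ).ncard : ℝ) * ∏ i, (2 * R i + 3) := by
  have h := ncard_box_le Λ hK R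
  have h' : ((box Λ R).ncard : ℝ) ≤ ((∏ i, (2 * ⌈R i⌉₊ + 1) : ℕ) : ℝ) * ((unitBox Λ).ncard : ℝ) := by
    exact_mod_cast h
  refine h'.trans ?_
  rw [mul_comm]
  refine mul_le_mul_of_nonneg_left ?_ (Nat.cast_nonneg _)
  push_cast
  refine Finset.prod_le_prod (fun i _ => by positivity) fun i _ => ?_
  have := two_ceil_add_one_le (R i) (hR i)
  push_cast at this
  exact this

/-- **the box count with a common side `R`**: `#{x ∈ Λ : ∀ i, |x i| ≤ R} ≤ K · 3^n · (1 + R)^n`,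
`n = card ι` — the polynomial count `C′ (1 + R)^β` with `β = n` of the dominant-term rows. -/
theorem ncard_box_const_le (Λ : AddSubgroup (ι → ℝ)) (hK : (unitBox Λ).Finite) (R : ℝ) (hR : 0 ≤ R) :
    ((box Λ fun _ => R).ncard : ℝ) ≤
      ((unitBox Λ).ncard : ℝ) * 3 ^ Fintype.card ι * (1 + R) ^ Fintype.card ι := by
  have h := ncard_box_le_real Λ hK (fun _ => R) (fun _ => hR)
  refine h.trans ?_
  rw [mul_assoc, ← mul_pow]
  refine mul_le_mul_of_nonneg_left ?_ (Nat.cast_nonneg _)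
  rw [Finset.prod_const, Finset.card_univ]
  refine pow_le_pow_left₀ (by positivity) ?_ _
  linarith

omit [DecidableEq ι] in
/-- the unit cube of `ι → ℝ` is the closed ball of radius `1` (sup norm). -/
theorem setOf_abs_le_one_eq : {x : ι → ℝ | ∀ i, |x i| ≤ 1} = Metric.closedBall (0 : ι → ℝ) 1 := by
  ext x
  simp only [Set.mem_setOf_eq, Metric.mem_closedBall, dist_zero_right,
    pi_norm_le_iff_of_nonneg zero_le_one, Real.norm_eq_abs]

omit [DecidableEq ι] in
/-- **a discrete subgroup has a finite unit box** (a closed discrete subset of a compact cube). -/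
theorem unitBox_finite_of_discrete (Λ : AddSubgroup (ι → ℝ)) [DiscreteTopology Λ] :
    (unitBox Λ).Finite := by
  have hΛ : IsClosed (Λ : Set (ι → ℝ)) := AddSubgroup.isClosed_of_discrete
  have hd : IsDiscrete (Λ : Set (ι → ℝ)) := isDiscrete_iff_discreteTopology.mpr ‹_›
  have hcube : IsCompact {x : ι → ℝ | ∀ i, |x i| ≤ 1} := by
    rw [setOf_abs_le_one_eq]; exact isCompact_closedBall 0 1
  have heq : unitBox Λ = (Λ : Set (ι → ℝ)) ∩ {x | ∀ i, |x i| ≤ 1} := rfl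
  have hc : IsCompact (unitBox Λ) := by rw [heq]; exact hcube.inter_left hΛ
  exact hc.finite (hd.mono fun x hx => hx.1)

/-- **the box count for a discrete subgroup**, all hypotheses intrinsic: for `Λ ⊆ ι → ℝ` discrete and sides
`R i ≥ 0`, `#{x ∈ Λ : ∀ i, |x i| ≤ R i} ≤ K · ∏ i, (2 R i + 3)` with `K = #(unit box) < ∞`. -/
theorem ncard_box_le_real_of_discrete (Λ : AddSubgroup (ι → ℝ)) [DiscreteTopology Λ] (R : ι → ℝ)
    (hR : ∀ i, 0 ≤ R i) :
    ((box Λ R).ncard : ℝ) ≤ ((unitBox Λ).ncard : ℝ) * ∏ i, (2 * R i + 3) :=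
  ncard_box_le_real Λ (unitBox_finite_of_discrete Λ) R hR

end Summit.Ventures.HodgeRepro2.Tier7.Line3.LatticeBoxCount
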